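import Literature.AlgebraicGeometry.HodgeTheory.MixedPowersRetract
import Literature.AlgebraicGeometry.HodgeTheory.StablyNondegenerateProducts
import Literature.AlgebraicGeometry.Motives.AbelianVarietyProductIsogeny
import HarnessLib

/-!
# `A₀^{n₀+1} × ⋯ × A_k^{n_k+1}` is a retract of a power of `A₀ × ⋯ × A_k`; `B = D` and the Hodge conjecture descend from the powers of a finite product to all its mixed powers

Family `hodge`, layer `Literature/AlgebraicGeometry/HodgeTheory`. Research context: cell `pub-hodge-ring2`
(HONEST FRAMING: research route conditional on HC_CM; not a corollary; Q11.4-sentence-2 already refuted in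
dim ≥ 3), Literature lane, programme R3 (mixed exponents, any number of factors). Elementary and UNCONDITIONAL;
one definition with body (`AbelianVariety.finProd`, the iterated product `((A₀ × A₁) × ⋯) × A_k` of a family indexed
by `Fin (k+1)`); no named fact.

* `AbelianVariety.finProd k A`, `finProd_zero`, `finProd_succ`;
* `prodMap_retract` — a retract in the first factor times the identity is a retract;
* **`exists_retract_finProd_powSucc`** — for exponents `n : Fin (k+1) → ℕ` there are `K` and
  `t : Π_i A_i^{n_i+1} ⟶ (Π_i A_i)^{K+1}`, `h` back, with `t ≫ h = 𝟙` (induction on `k`: `prodMap` of the previous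
  retract with `𝟙`, then the two-factor retract `mixedPowersIncl`/`mixedPowersProj` of `MixedPowersRetract`);
* **`IsDivisorGenerated.finProd_powSucc_of_forall`**, **`HodgeConjectureFor.finProd_powSucc_of_forall`** — `B = D`,
  resp. the Hodge conjecture, for all powers of `Π_i A_i` implies the same for every `Π_i A_i^{n_i+1}`
  (`…of_comp_eq_nsmul_id`, van Geemen §2.4–2.5 / Lemma 3.7);
* `powSuccMap`, `powPowIncl`/`powPowProj` (`(X^{a+1})^{b+1}` is a retract of `X^{(a+1)(b+1)}`),
  **`IsStablyNondegenerate.of_retract_powSucc`**, **`IsStablyNondegenerate.finProd_powSucc`** (condition (D) for a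
  finite product passes to ALL its mixed powers), `IsStablyNondegenerate.powSucc_prod_powSucc`, `.powSucc`.

## References

* [MumfordAV1970] D. Mumford, *Abelian Varieties*, §19. [cite: MumfordAV1970, §19 (Hom(C, A × B) = Hom(C, A) ⊕ Hom(C, B))]
* [vanGeemen1994HodgeAV] B. van Geemen, LNM 1594 (1994), §2.4–2.5 and Lemma 3.7.
  [cite: vanGeemen1994HodgeAV, §2.4–2.5 (p. 235) and §3.6–3.7 (p. 236)]
-/

noncomputable section

open CategoryTheory

namespace Literature.AlgebraicGeometry.HodgeTheory

open Literature.AlgebraicGeometry.Motives Literature.AlgebraicGeometry.Milne1999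

/-- **The iterated product `((A₀ × A₁) × ⋯) × A_k`** of a family of abelian varieties indexed by `Fin (k + 1)`.
[cite: MumfordAV1970, §19 (Hom(C, A × B) = Hom(C, A) ⊕ Hom(C, B))] -/
def AbelianVariety.finProd : (k : ℕ) → (Fin (k + 1) → AbelianVariety ℂ) → AbelianVariety ℂ
  | 0, A => A 0
  | k + 1, A => (AbelianVariety.finProd k fun i => A i.castSucc).prod (A (Fin.last (k + 1)))

/-- `finProd 0 A = A 0`. [cite: MumfordAV1970, §19 (Hom(C, A × B) = Hom(C, A) ⊕ Hom(C, B))] -/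
theorem AbelianVariety.finProd_zero (A : Fin 1 → AbelianVariety ℂ) : AbelianVariety.finProd 0 A = A 0 := rfl

/-- `finProd (k+1) A = finProd k (A ∘ castSucc) × A (last)`. [cite: MumfordAV1970, §19 (Hom(C, A × B) = Hom(C, A) ⊕ Hom(C, B))] -/
theorem AbelianVariety.finProd_succ (k : ℕ) (A : Fin (k + 2) → AbelianVariety ℂ) :
    AbelianVariety.finProd (k + 1) A =
      (AbelianVariety.finProd k fun i => A i.castSucc).prod (A (Fin.last (k + 1))) := rfl

/-- **A retract in the first factor times the identity is a retract**: `(t × 𝟙) ≫ (h × 𝟙) = 𝟙` when `t ≫ h = 𝟙`.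
[cite: MumfordAV1970, §19 (Hom(C, A × B) = Hom(C, A) ⊕ Hom(C, B))] -/
theorem prodMap_retract {X Y Z : AbelianVariety ℂ} (t : X ⟶ Y) (h : Y ⟶ X) (hth : t ≫ h = 𝟙 X) :
    AbelianVariety.prodMap t (𝟙 Z) ≫ AbelianVariety.prodMap h (𝟙 Z) = 𝟙 (X.prod Z) := by
  apply AbelianVariety.prod_hom_ext
  · rw [Category.assoc, AbelianVariety.prodMap_fst, AbelianVariety.prodMap_fst_assoc, hth, Category.comp_id,
      Category.id_comp]
  · rw [Category.assoc, AbelianVariety.prodMap_snd, AbelianVariety.prodMap_snd_assoc, Category.comp_id,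
      Category.comp_id, Category.id_comp]

/-- **`A₀^{n₀+1} × ⋯ × A_k^{n_k+1}` is a retract of `(A₀ × ⋯ × A_k)^{K+1}` for some `K`.**
[cite: MumfordAV1970, §19 (Hom(C, A × B) = Hom(C, A) ⊕ Hom(C, B))] -/
theorem exists_retract_finProd_powSucc : ∀ (k : ℕ) (A : Fin (k + 1) → AbelianVariety ℂ) (n : Fin (k + 1) → ℕ),
    ∃ (K : ℕ) (t : AbelianVariety.finProd k (fun i => (A i).powSucc (n i)) ⟶ (AbelianVariety.finProd k A).powSucc K)
      (h : (AbelianVariety.finProd k A).powSucc K ⟶ AbelianVariety.finProd k (fun i => (A i).powSucc (n i))),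
      t ≫ h = 𝟙 _
  | 0, A, n => ⟨n 0, 𝟙 _, 𝟙 _, Category.comp_id _⟩
  | k + 1, A, n => by
    obtain ⟨K₀, t₀, h₀, ht₀⟩ :=
      exists_retract_finProd_powSucc k (fun i => A i.castSucc) (fun i => n i.castSucc)
    refine ⟨max K₀ (n (Fin.last (k + 1))),
      AbelianVariety.prodMap t₀ (𝟙 _) ≫ mixedPowersIncl (AbelianVariety.finProd k fun i => A i.castSucc)
        (A (Fin.last (k + 1))) K₀ (n (Fin.last (k + 1))) (max K₀ (n (Fin.last (k + 1)))),
      mixedPowersProj (AbelianVariety.finProd k fun i => A i.castSucc) (A (Fin.last (k + 1))) K₀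
        (n (Fin.last (k + 1))) (max K₀ (n (Fin.last (k + 1)))) (le_max_left _ _) (le_max_right _ _) ≫
        AbelianVariety.prodMap h₀ (𝟙 _), ?_⟩
    set ι := mixedPowersIncl (AbelianVariety.finProd k fun i => A i.castSucc) (A (Fin.last (k + 1))) K₀
      (n (Fin.last (k + 1))) (max K₀ (n (Fin.last (k + 1)))) with hι
    set π := mixedPowersProj (AbelianVariety.finProd k fun i => A i.castSucc) (A (Fin.last (k + 1))) K₀
      (n (Fin.last (k + 1))) (max K₀ (n (Fin.last (k + 1)))) (le_max_left _ _) (le_max_right _ _) with hπ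
    have hιπ : ι ≫ π = 𝟙 _ := mixedPowersIncl_comp_mixedPowersProj _ _ _ _ _
    calc (AbelianVariety.prodMap t₀ (𝟙 _) ≫ ι) ≫ (π ≫ AbelianVariety.prodMap h₀ (𝟙 _))
        = AbelianVariety.prodMap t₀ (𝟙 _) ≫ (ι ≫ π) ≫ AbelianVariety.prodMap h₀ (𝟙 _) := by
          simp only [Category.assoc]
      _ = 𝟙 _ := by rw [hιπ, Category.id_comp]; exact prodMap_retract t₀ h₀ ht₀

/-- **`B = D` for every mixed power `Π_i A_i^{n_i+1}` from `B = D` for all powers of `Π_i A_i`.**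
[cite: vanGeemen1994HodgeAV, §2.4–2.5 (p. 235) and §3.6–3.7 (p. 236)] -/
theorem IsDivisorGenerated.finProd_powSucc_of_forall {k : ℕ} {A : Fin (k + 1) → AbelianVariety ℂ}
    (h : ∀ K, IsDivisorGenerated ((AbelianVariety.finProd k A).powSucc K)) (n : Fin (k + 1) → ℕ) :
    IsDivisorGenerated (AbelianVariety.finProd k (fun i => (A i).powSucc (n i))) := by
  obtain ⟨K, t, hh, ht⟩ := exists_retract_finProd_powSucc k A n
  exact IsDivisorGenerated.of_comp_eq_nsmul_id t hh one_ne_zero (by rw [ht, one_smul]) (h K)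

/-- **The Hodge conjecture for every mixed power `Π_i A_i^{n_i+1}` from the Hodge conjecture for all powers of `Π_i A_i`.**
[cite: vanGeemen1994HodgeAV, §3.6–3.7 Lemma 3.7 (p. 236)] -/
theorem HodgeConjectureFor.finProd_powSucc_of_forall {k : ℕ} {A : Fin (k + 1) → AbelianVariety ℂ}
    (h : ∀ K, HodgeConjectureFor ((AbelianVariety.finProd k A).powSucc K).dim ((AbelianVariety.finProd k A).powSucc K).X)
    (n : Fin (k + 1) → ℕ) :
    HodgeConjectureFor (AbelianVariety.finProd k (fun i => (A i).powSucc (n i))).dim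
      (AbelianVariety.finProd k (fun i => (A i).powSucc (n i))).X := by
  obtain ⟨K, t, hh, ht⟩ := exists_retract_finProd_powSucc k A n
  exact HodgeConjectureFor.of_comp_eq_nsmul_id t hh one_ne_zero (by rw [ht, one_smul]) (h K)

/-! ### Powers of retracts and powers of powers: condition (D) descends to retracts of powers and to all mixed powers -/

section PowersOfPowers

variable {X Y : AbelianVariety ℂ}

/-- **The componentwise map `f^{a+1} : X^{a+1} ⟶ Y^{a+1}`.** [cite: MumfordAV1970, §19 (Hom(C, A × B) = Hom(C, A) ⊕ Hom(C, B))] -/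
def powSuccMap (f : X ⟶ Y) (a : ℕ) : X.powSucc a ⟶ Y.powSucc a :=
  powLift a fun r => powProj X a r ≫ f

/-- Components of `f^{a+1}`. [cite: MumfordAV1970, §19 (Hom(C, A × B) = Hom(C, A) ⊕ Hom(C, B))] -/
theorem powSuccMap_powProj (f : X ⟶ Y) (a : ℕ) (r : Fin (a + 1)) :
    powSuccMap f a ≫ powProj Y a r = powProj X a r ≫ f :=
  powLift_powProj _ _ _

/-- `t^{a+1} ≫ h^{a+1} = 𝟙` when `t ≫ h = 𝟙`. [cite: MumfordAV1970, §19 (Hom(C, A × B) = Hom(C, A) ⊕ Hom(C, B))] -/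
theorem powSuccMap_retract (t : X ⟶ Y) (h : Y ⟶ X) (hth : t ≫ h = 𝟙 X) (a : ℕ) :
    powSuccMap t a ≫ powSuccMap h a = 𝟙 (X.powSucc a) :=
  pow_hom_ext _ fun r => by
    rw [Category.assoc, powSuccMap_powProj, ← Category.assoc, powSuccMap_powProj, Category.assoc, hth,
      Category.comp_id, Category.id_comp]

/-- The index bijection `Fin (b+1) × Fin (a+1) ≃ Fin (a + b (a+1) + 1)` (`(b+1)(a+1) = a + b(a+1) + 1`).
[cite: MumfordAV1970, §19 (Hom(C, A × B) = Hom(C, A) ⊕ Hom(C, B))] -/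
def powPowIdx (a b : ℕ) : Fin (b + 1) × Fin (a + 1) ≃ Fin (a + b * (a + 1) + 1) :=
  finProdFinEquiv.trans (finCongr (by ring))

/-- **`(X^{a+1})^{b+1} ⟶ X^{(a+1)(b+1)}`** (component `(q, r) ↦ pr_r ∘ pr_q`).
[cite: MumfordAV1970, §19 (Hom(C, A × B) = Hom(C, A) ⊕ Hom(C, B))] -/
def powPowIncl (X : AbelianVariety ℂ) (a b : ℕ) : (X.powSucc a).powSucc b ⟶ X.powSucc (a + b * (a + 1)) :=
  powLift _ fun j => powProj (X.powSucc a) b ((powPowIdx a b).symm j).1 ≫ powProj X a ((powPowIdx a b).symm j).2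

/-- **`X^{(a+1)(b+1)} ⟶ (X^{a+1})^{b+1}`** (the inverse regrouping). [cite: MumfordAV1970, §19 (Hom(C, A × B) = Hom(C, A) ⊕ Hom(C, B))] -/
def powPowProj (X : AbelianVariety ℂ) (a b : ℕ) : X.powSucc (a + b * (a + 1)) ⟶ (X.powSucc a).powSucc b :=
  powLift b fun q => powLift a fun r => powProj X (a + b * (a + 1)) (powPowIdx a b (q, r))

/-- `powPowIncl ≫ powPowProj = 𝟙`: `(X^{a+1})^{b+1}` is a retract of `X^{(a+1)(b+1)}`.
[cite: MumfordAV1970, §19 (Hom(C, A × B) = Hom(C, A) ⊕ Hom(C, B))] -/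
theorem powPowIncl_comp_powPowProj (X : AbelianVariety ℂ) (a b : ℕ) :
    powPowIncl X a b ≫ powPowProj X a b = 𝟙 _ := by
  refine pow_hom_ext _ fun q => pow_hom_ext _ fun r => ?_
  have h1 : powPowProj X a b ≫ powProj (X.powSucc a) b q =
      powLift a fun r => powProj X (a + b * (a + 1)) (powPowIdx a b (q, r)) := powLift_powProj _ _ _
  have h2 : (powLift a fun r => powProj X (a + b * (a + 1)) (powPowIdx a b (q, r))) ≫ powProj X a r =
      powProj X (a + b * (a + 1)) (powPowIdx a b (q, r)) := powLift_powProj _ _ _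
  have h3 : powPowIncl X a b ≫ powProj X (a + b * (a + 1)) (powPowIdx a b (q, r)) =
      powProj (X.powSucc a) b q ≫ powProj X a r := by
    rw [powPowIncl, powLift_powProj, Equiv.symm_apply_apply]
  rw [Category.id_comp, Category.assoc (powPowIncl X a b), h1, Category.assoc, h2, h3]

/-- **`B = D` on `(X^{a+1})^{b+1}` from `B = D` on `X^{(a+1)(b+1)}`.** [cite: vanGeemen1994HodgeAV, §2.4–2.5 (p. 235) and §3.6–3.7 (p. 236)] -/
theorem IsDivisorGenerated.powSucc_powSucc_of_powSucc {a b : ℕ} (h : IsDivisorGenerated (X.powSucc (a + b * (a + 1)))) :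
    IsDivisorGenerated ((X.powSucc a).powSucc b) :=
  IsDivisorGenerated.of_comp_eq_nsmul_id (powPowIncl X a b) (powPowProj X a b) one_ne_zero
    (by rw [powPowIncl_comp_powPowProj, one_smul]) h

/-- **Condition (D) descends to retracts of powers**: if `t : M ⟶ P^{K₀+1}`, `h : P^{K₀+1} ⟶ M`, `t ≫ h = 𝟙`, and every
power of `P` has `B = D`, then every power of `M` has `B = D` (`M^{K+1}` is a retract of `(P^{K₀+1})^{K+1}`, itself a
retract of `P^{(K₀+1)(K+1)}`). [cite: vanGeemen1994HodgeAV, §2.4–2.5 (p. 235) and §3.6–3.7 (p. 236)] -/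
theorem IsStablyNondegenerate.of_retract_powSucc {M P : AbelianVariety ℂ} {K₀ : ℕ} (t : M ⟶ P.powSucc K₀)
    (h : P.powSucc K₀ ⟶ M) (hth : t ≫ h = 𝟙 M) (hP : IsStablyNondegenerate P) : IsStablyNondegenerate M := by
  rw [isStablyNondegenerate_iff] at hP ⊢
  intro K
  refine IsDivisorGenerated.of_comp_eq_nsmul_id (powSuccMap t K) (powSuccMap h K) one_ne_zero
    (by rw [powSuccMap_retract t h hth, one_smul]) ?_
  exact IsDivisorGenerated.powSucc_powSucc_of_powSucc (hP _)

/-- **Condition (D) for a finite product passes to all its mixed powers**: if `A₀ × ⋯ × A_k` is stably nondegenerate,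
so is every `A₀^{n₀+1} × ⋯ × A_k^{n_k+1}`. [cite: vanGeemen1994HodgeAV, §2.4–2.5 (p. 235) and §3.6–3.7 (p. 236)] -/
theorem IsStablyNondegenerate.finProd_powSucc {k : ℕ} {A : Fin (k + 1) → AbelianVariety ℂ}
    (h : IsStablyNondegenerate (AbelianVariety.finProd k A)) (n : Fin (k + 1) → ℕ) :
    IsStablyNondegenerate (AbelianVariety.finProd k (fun i => (A i).powSucc (n i))) := by
  obtain ⟨K, t, hh, ht⟩ := exists_retract_finProd_powSucc k A n
  exact IsStablyNondegenerate.of_retract_powSucc t hh ht h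

/-- In particular (two factors): `A^{M+1} × B^{N+1}` is stably nondegenerate when `A × B` is.
[cite: vanGeemen1994HodgeAV, §2.4–2.5 (p. 235) and §3.6–3.7 (p. 236)] -/
theorem IsStablyNondegenerate.powSucc_prod_powSucc {A B : AbelianVariety ℂ} (h : IsStablyNondegenerate (A.prod B))
    (M N : ℕ) : IsStablyNondegenerate ((A.powSucc M).prod (B.powSucc N)) :=
  IsStablyNondegenerate.of_retract_powSucc (mixedPowersIncl A B M N (max M N))
    (mixedPowersProj A B M N (max M N) (le_max_left _ _) (le_max_right _ _))
    (mixedPowersIncl_comp_mixedPowersProj _ _ _ _ _) h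

/-- A power of a stably nondegenerate abelian variety is stably nondegenerate.
[cite: vanGeemen1994HodgeAV, §2.4–2.5 (p. 235) and §3.6–3.7 (p. 236)] -/
theorem IsStablyNondegenerate.powSucc {X : AbelianVariety ℂ} (h : IsStablyNondegenerate X) (a : ℕ) :
    IsStablyNondegenerate (X.powSucc a) :=
  IsStablyNondegenerate.of_retract_powSucc (𝟙 _) (𝟙 _) (Category.comp_id _) h

end PowersOfPowers

end Literature.AlgebraicGeometry.HodgeTheory

end
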